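import Mathlib
import Summits.CriticalPhenomena.CardyFormulaZ2.Theorems.CardyMagicRigidityDefs
import Summits.CriticalPhenomena.CardyFormulaZ2.Theorems.CardyMagicRigidityPositiveConeDefs
import Summits.CriticalPhenomena.CardyFormulaZ2.Theorems.CardyMagicRigidityNestingRigidityLatticeRegularityZ2Boundary
import Summits.CriticalPhenomena.CardyFormulaZ2.Theorems.CardyMagicRigidityNestingRigidityStaircaseCloud
import Summits.CriticalPhenomena.CardyFormulaZ2.Theorems.CardyMagicRigidityNestingRigidityConeTiltLoopSide
import Literature.Probability.Percolation.FKLoopNestingDensityLimit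
import HarnessLib

/-!
# Crux `NestingRigidity`, line `ring-cloud-tomography` (r5): the GAP TOWERS of the staircase
# (stub R2' `stub_staircaseDecoupling`) — deterministic phases, and emptied by a gap crossing

Crux `Summit.CriticalPhenomena.CardyFormulaZ2.Theses.CardyMagicRigidity.NestingRigidity`
(stmt-CriticalPhenomena-4835), line `ring-cloud-tomography`, stub R2'.  Companion of
`…StaircasePathwise` (the factorisation `A = g_tot · U_rest`, `g_tot` = weights of the window tower and
of the gap towers) and of `…GapCrossing` / `…GapTower` (gap crossings are rare, also under a tower tilt).
Two deterministic facts about the gap tower of the gap `A(0; M j, L (j+1))` of the staircase cloud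
(bump `t·ρ_{B(0,r)}` plus `k` rings `A(0; L j, M j)` of equal charge `−t/k`):
* §1 `Staircase.nestingPhase_of_gapTower` / `nestingFactor_of_gapTower`: a loop surrounding
  `B̄(0, M j)` with trace inside `B(0, L j')`, no ring strictly between `j < j'`, swallows the bump and
  the rings `≤ j` and bites no other ring: its phase is EXACTLY `t + (j+1)(−t/k)`, so the gap tower
  `j` contributes the deterministic factor `w(t + (j+1)(−t/k))^{N_j}` to the functional — these factors
  must NEVER be linearised (log-many `O(1)` phases), and the staircase should keep every such phase in
  `[−2π/3, 0]`, i.e. `w ≥ 1` (with equal charges: `t + (−t/k) ≥ −2π/3`, e.g. `k = 5` for every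
  `t ∈ (−5π/6, −π/2)`), so that the signed part is negligible gap by gap;
* §2 plane topology of `Regular` configurations (laminar winding interiors, trace = frontier of the
  interior), hence surely on both lattices (`regular_latticeEnsembles`): if some loop of `c` meets
  `B̄(x, a)` and `ℂ ∖ B(x, b)` then NO loop of `c` surrounds `B̄(x, a)` inside `B(x, b)`,
  `towerCount c x a b = 0` (`GapCrossing.towerCount_eq_zero_of_cross`; registered anchor
  `towerCount_eq_zero_of_loop_cross_latticeEnsembles`): on the bad event of gap `j` the gap tower
  factor is `1`.
-/

noncomputable section

open MeasureTheory Set Filter Metric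
open scoped Real Topology BigOperators

namespace Summit.CriticalPhenomena.CardyFormulaZ2.Cruxes.NestingRigidity.RingCloudTomography

open Literature.Probability.RandomPlanarGeometry Literature.Probability.Percolation
  Literature.Probability.LatticeModels
open Summit.CriticalPhenomena.CardyFormulaZ2.Cruxes.NestingRigidity.PositiveConeWeightDoubling
  (magicWeight Regular regular_latticeEnsembles)

namespace Staircase

section StaircaseCloud

variable {𝔠 : Cloud} {t r : ℝ} {k : ℕ} {L M : Fin k → ℝ}
  (h𝔠 : 𝔠 = Cloud.mk 1 k (fun _ ↦ 0) (fun _ ↦ r) (fun _ ↦ t) (fun _ ↦ 0) L M (fun _ ↦ -t / k))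
include h𝔠

/-! ## §1 Gap towers carry deterministic phases -/

/-- **Exact phase of a gap-tower loop.**  For separated rings (`M i ≤ L l` for `i < l`), a loop whose
winding interior contains `B̄(0, M j)` and whose trace lies in `B(0, L j')` for some `j < j'` with no
ring strictly between (`∀ i, j < i → j' ≤ i`) swallows the bump and the rings `≤ j` and bites no ring
`≥ j'`: its phase is `t + (j + 1) · (−t/k)`. -/
theorem nestingPhase_of_gapTower (hr : 0 < r) (hrL : ∀ j, r ≤ L j) (hL : ∀ j, 0 < L j)
    (hLM : ∀ j, L j < M j) (hsep : ∀ i l : Fin k, i < l → M i ≤ L l) {j j' : Fin k} (hjj' : j < j')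
    (hnext : ∀ i : Fin k, j < i → j' ≤ i) {u : UnbasedLoop ℂ}
    (hin : closedBall (0 : ℂ) (M j) ⊆ {z | u.wind z ≠ 0}) (hout : u.range ⊆ ball (0 : ℂ) (L j')) :
    u.nestingPhase 𝔠.density = t + ((j : ℕ) + 1) * (-t / k) := by
  rw [nestingPhase_eq h𝔠]
  have hU : {z | u.wind z ≠ 0} ⊆ ball (0 : ℂ) (L j') := ConeTilt.setOf_wind_ne_zero_subset_ball hout
  -- the bump is swallowed
  have h₀ : ∫ z in {z | u.wind z ≠ 0}, discDensity 0 r z = 1 :=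
    ConeTilt.setIntegral_discDensity_eq_one 0 hr fun w hw ↦ hin (mem_closedBall_zero_iff.2
      (by linarith [hrL j, hLM j, mem_ball_zero_iff.1 hw]))
  -- rings `≤ j` are swallowed, rings `≥ j'` are not bitten
  have hring : ∀ i : Fin k, ∫ z in {z | u.wind z ≠ 0}, annulusDensity 0 (L i) (M i) z =
      if i ≤ j then 1 else 0 := by
    intro i
    split_ifs with hij
    · -- swallowed: the ring lies in `B̄(0, M j)`
      have hMM : M i ≤ M j := by
        rcases lt_or_eq_of_le hij with hlt | rfl
        · exact (hsep i j hlt).trans (hLM j).le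
        · exact le_rfl
      rw [setIntegral_eq_integral_of_forall_compl_eq_zero fun z hz ↦ ?_,
        CloudAdmissibility.integral_annulusDensity 0 (hL i) (hLM i)]
      refine Set.indicator_of_notMem (fun hz' ↦ hz (hin (mem_closedBall_zero_iff.2 ?_))) _
      have := hz'.2; simp only [sub_zero] at this; linarith
    · -- not bitten: the ring lies outside `B(0, L j')`
      have hi : j' ≤ i := hnext i (not_le.1 hij)
      have hLL : L j' ≤ L i := by
        rcases lt_or_eq_of_le hi with hlt | rfl
        · exact ((hLM j').le.trans (hsep j' i hlt))
        · exact le_rfl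
      refine ConeTilt.setIntegral_annulusDensity_eq_zero 0 (L i) (M i)
        (Set.disjoint_left.2 fun z hz hz' ↦ ?_)
      have h1 := mem_ball_zero_iff.1 (hU hz)
      have h2 := hz'.1; simp only [sub_zero] at h2
      linarith
  simp_rw [hring, h₀]
  rw [Finset.sum_ite, Finset.sum_const_zero, add_zero, Finset.sum_const, nsmul_eq_mul, mul_one]
  have hcard : ((Finset.univ.filter fun i : Fin k ↦ i ≤ j).card : ℝ) = (j : ℕ) + 1 := by
    rw [show (Finset.univ.filter fun i : Fin k ↦ i ≤ j) = Finset.Iic j by ext i; simp, Fin.card_Iic]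
    push_cast; ring
  rw [hcard]; ring

/-- Hence a gap-tower loop has the deterministic weight `w(t + (j+1)(−t/k))`. -/
theorem nestingFactor_of_gapTower (hr : 0 < r) (hrL : ∀ j, r ≤ L j) (hL : ∀ j, 0 < L j)
    (hLM : ∀ j, L j < M j) (hsep : ∀ i l : Fin k, i < l → M i ≤ L l) {j j' : Fin k} (hjj' : j < j')
    (hnext : ∀ i : Fin k, j < i → j' ≤ i) {u : UnbasedLoop ℂ}
    (hin : closedBall (0 : ℂ) (M j) ⊆ {z | u.wind z ≠ 0}) (hout : u.range ⊆ ball (0 : ℂ) (L j')) :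
    u.nestingFactor 𝔠.density = magicWeight (t + ((j : ℕ) + 1) * (-t / k)) := by
  rw [UnbasedLoop.nestingFactor, nestingPhase_of_gapTower h𝔠 hr hrL hL hLM hsep hjj' hnext hin hout]; rfl

end StaircaseCloud

/-- **The gap-tower weight is `≥ 1` exactly when its phase is `≥ −2π/3`** (for phases `≤ 0`): for
`θ ∈ [−2π/3, 0]`, `1 ≤ w(θ) = 2cos(θ + π/3)`.  With equal ring charges the smallest gap-tower phase is
`t + (−t/k)`, so `k` with `t − t/k ≥ −2π/3` (e.g. `k = 5` on the whole partner range) keeps every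
gap tower factor `≥ 1`. -/
theorem one_le_magicWeight_of_mem_Icc {θ : ℝ} (hθ : θ ∈ Set.Icc (-(2 * π / 3)) 0) : 1 ≤ magicWeight θ := by
  rw [magicWeight, show (1 : ℝ) = 2 * Real.cos (π / 3) by rw [Real.cos_pi_div_three]; norm_num]
  refine mul_le_mul_of_nonneg_left ?_ two_pos.le
  rcases le_total 0 (θ + π / 3) with h | h
  · exact Real.cos_le_cos_of_nonneg_of_le_pi h (by linarith [Real.pi_pos]) (by linarith [hθ.2])
  · rw [← Real.cos_neg (θ + π / 3)]
    exact Real.cos_le_cos_of_nonneg_of_le_pi (by linarith) (by linarith [Real.pi_pos]) (by linarith [hθ.1])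

end Staircase

namespace GapCrossing

/-! ## §2 A crossing loop kills the tower (plane topology of regular configurations) -/

/-- **A crossing loop and a tower loop of one LAMINAR configuration are incompatible.**  Let `u, v` be
loops whose winding interiors are nested or disjoint and whose traces are the frontiers of their
winding interiors (two fields of `Regular`).  If the trace of `u` meets `B̄(x, a)` and `ℂ ∖ B(x, b)`,
then `v` cannot surround `B̄(x, a)` with trace inside `B(x, b)`: the inner trace point of `u` is
interior to `v` and adherent to `int u`, so the interiors meet; `int v ⊆ int u` would put that trace
point of `u` inside `int u`; `int u ⊆ int v` would make the outer trace point of `u` (where `W(v) = 0`,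
off the trace of `v`) adherent to `int v`. -/
theorem not_tower_of_cross {u v : UnbasedLoop ℂ}
    (hlam : {z | u.wind z ≠ 0} ⊆ {z | v.wind z ≠ 0} ∨ {z | v.wind z ≠ 0} ⊆ {z | u.wind z ≠ 0} ∨
      Disjoint {z | u.wind z ≠ 0} {z | v.wind z ≠ 0})
    (hbu : u.range = frontier {z | u.wind z ≠ 0}) (hbv : v.range = frontier {z | v.wind z ≠ 0})
    {x : ℂ} {a b : ℝ} (hua : (u.range ∩ closedBall x a).Nonempty)
    (hub : (u.range ∩ (ball x b)ᶜ).Nonempty) (hva : closedBall x a ⊆ {z | v.wind z ≠ 0})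
    (hvb : v.range ⊆ ball x b) : False := by
  obtain ⟨p, hpu, hpa⟩ := hua
  obtain ⟨q, hqu, hqb⟩ := hub
  set Iu : Set ℂ := {z | u.wind z ≠ 0} with hIu
  set Iv : Set ℂ := {z | v.wind z ≠ 0} with hIv
  have hIuo : IsOpen Iu := u.isOpen_setOf_wind_ne_zero
  have hIvo : IsOpen Iv := v.isOpen_setOf_wind_ne_zero
  have hpv : p ∈ Iv := hva hpa
  have hqv : v.wind q = 0 :=
    v.wind_eq_zero_of_subset_ball hvb (not_lt.1 fun h ↦ hqb (mem_ball.2 h))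
  -- the interiors meet near `p`
  have hpcl : p ∈ closure Iu := frontier_subset_closure (hbu ▸ hpu)
  have hmeet : (Iv ∩ Iu).Nonempty := mem_closure_iff.1 hpcl Iv hIvo hpv
  rcases hlam with h | h | h
  · -- `int u ⊆ int v`: the outer trace point `q` of `u` adheres to `int v`
    have hqcl : q ∈ closure Iv := closure_mono h (frontier_subset_closure (hbu ▸ hqu))
    rw [closure_eq_self_union_frontier, ← hbv] at hqcl
    rcases hqcl with hq | hq
    · exact hq hqv
    · exact hqb (hvb hq)
  · -- `int v ⊆ int u`: the trace point `p` of `u` lies in `int u`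
    have hpIu : p ∈ Iu := h hpv
    have : p ∈ frontier Iu := hbu ▸ hpu
    rw [hIuo.frontier_eq] at this
    exact this.2 hpIu
  · exact Set.disjoint_iff_inter_eq_empty.1 h.symm ▸ hmeet |>.ne_empty rfl

/-- **On a regular configuration a loop crossing `A(x; a, b)` empties the tower**: if some loop of `c`
meets both `B̄(x, a)` and `ℂ ∖ B(x, b)`, no loop of `c` surrounds `B̄(x, a)` inside `B(x, b)`, i.e.
`towerCount c x a b = 0`. -/
theorem towerCount_eq_zero_of_cross {c : LoopConfig ℂ} (hc : Regular c) {x : ℂ} {a b : ℝ}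
    (h : ∃ u ∈ c.loops, (u.range ∩ closedBall x a).Nonempty ∧ (u.range ∩ (ball x b)ᶜ).Nonempty) :
    towerCount c x a b = 0 := by
  obtain ⟨u, hu, hua, hub⟩ := h
  have hempty : {v ∈ c.loops | closedBall x a ⊆ {z | v.wind z ≠ 0} ∧ v.range ⊆ ball x b} = ∅ :=
    Set.eq_empty_of_forall_notMem fun v hv ↦ not_tower_of_cross (hc.laminar u hu v hv.1)
      (hc.boundary u hu) (hc.boundary v hv.1) hua hub hv.2.1 hv.2.2
  rw [towerCount, hempty, Set.ncard_empty]

end GapCrossing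

/-- **Registered anchor — both lattice ensembles: a gap-crossing loop of `X_δ(ω)` empties the tower of
the gap** (every mesh `δ > 0`, every sample; `regular_latticeEnsembles` +
`GapCrossing.towerCount_eq_zero_of_cross`). -/
theorem towerCount_eq_zero_of_loop_cross_latticeEnsembles : ∀ E ∈ latticeEnsembles, ∀ {δ : ℝ},
    0 < δ → ∀ (ω : E.Ω) (x : ℂ) (a b : ℝ),
    (∃ u ∈ (E.X δ ω).loops, (u.range ∩ Metric.closedBall x a).Nonempty ∧ (u.range ∩ (Metric.ball x b)ᶜ).Nonempty) →
    towerCount (E.X δ ω) x a b = 0 :=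
  fun E hE _ hδ ω _ _ _ h ↦ GapCrossing.towerCount_eq_zero_of_cross (regular_latticeEnsembles E hE hδ ω) h

end Summit.CriticalPhenomena.CardyFormulaZ2.Cruxes.NestingRigidity.RingCloudTomography

end
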